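import Summits.Ventures.CertifiedManyBodySolver.Rows.TorusCeilingLatHom
import Literature.MathematicalPhysics.QuantumLattice.TorusPlaquetteProductStates
import Literature.MathematicalPhysics.QuantumLattice.SourcedHubbardBlockCut
import Literature.MathematicalPhysics.QuantumLattice.InterClusterKernelIdentification
import Literature.MathematicalPhysics.QuantumLattice.HubbardSzSectorLadder
import Literature.MathematicalPhysics.QuantumLattice.SectorGroundProjContinuity
import Literature.MathematicalPhysics.QuantumLattice.FinDimSpectrumSectorGibbsLimit
import HarnessLib

/-!
# Torus ceiling — Part V-d(i): the tilted torus `Λ₁₆″ = ⟨(4,0),(2,4)⟩` on SIXTEEN sites —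
# cosets, carrier graph and block decomposition of its `(ℤ/8)²` presentation

HONEST FRAMING: first certified bounds; not a superconductivity verdict; every number certified or
labelled float.

Part V-c (`TorusCeilingLatHom`) transported square-lattice NN-Hubbard window certificates of coordinate
spreads `≤ 3, ≤ 3` to the 64-site model `homHubbard tiltHom16b t U` on `(ℤ/8)²` with hops
`±(4,2), ±(0,1)` — the disjoint union of FOUR copies of the nearest-neighbour Hubbard model of the
tilted 16-site torus `ℤ²/Λ₁₆″`, `Λ₁₆″ = ⟨(4,0),(2,4)⟩` (quotient group `ℤ/2 × ℤ/8`, one copy per coset of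
the image `{0,4} × ℤ/8` of `tiltHom16b`), and recorded as a PAPER step the comparison of that 64-site
sector energy with ONE 16-site copy. This file and its sequel `TorusCeilingTilt16bProduct` close that
step in the kernel. Here:

* §1 the coset embeddings `cosetSite r : FermionTorus 1 16 ↪o FermionTorus 2 8`,
  `n ↦ (r + 4⌊n/8⌋, n mod 8)` (`r < 4`; order embeddings for the lexicographic = Jordan–Wigner orders),
  their inverse coordinates `blockOf16b` / `posOf16b`, and the two cluster partitions (sites, orbitals)
  in the sense of `Literature/…/ClusterProductStates` (`ClusterProduct.Partition`);
* §2 the 16-site carrier graph `tilt16bGraph` = pull-back of `homTorusGraph tiltHom16b` along the coset-`0`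
  embedding — explicitly (`tilt16bGraph` is the Cayley graph of `ℤ/2 × ℤ/8` for `±(0,1), ±(1,2)` read
  through `n = 8a + b`): `n ∼ m` iff (same octet and `n − m ≡ ±1 (mod 8)`) or (different octets and
  `n − m ≡ ±2 (mod 8)`); the same adjacency inside EVERY coset (translation by `(r,0)` is a graph
  automorphism) and NO bond between different cosets (`±(4,2), ±(0,1)` preserve `x₀ mod 4`); hence the
  block decomposition `homHubbard tiltHom16b t U = Σ_{r<4} jwEmbed (orbEmb (cosetSite r)) (hamiltonian tilt16bGraph t U)`
  (`sourced_sub_sum_jwEmbed_sub_onSiteSum_eq` with no cross bonds and no left-over sites).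

References: Bratteli–Robinson II §5.2.2 (CAR algebra of a direct sum) [BratteliRobinsonII1997];
Tasaki (2020) §2.2 [Tasaki2020]. Tree: `TorusCeilingLatHom` (Part V-c), `ClusterProductStates`,
`SourcedHubbardBlockCut`, `TorusPlaquetteHamiltonian` (the pattern followed here).
-/

noncomputable section

open Matrix Finset
open Literature.MathematicalPhysics.QuantumLattice
open Literature.MathematicalPhysics.QuantumFieldTheory hiding Site
open Literature.MathematicalPhysics.QuantumManyBody.StateRelaxation
open Literature.Probability.LatticeModels
open HubbardWave0 JWEmbed TwoCluster
open scoped ComplexOrder ComplexConjugate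

namespace Summit.Ventures.CertifiedManyBodySolver.Rows

section Tilt16bCosets

/-! ### §1. The four cosets as order embeddings of a 16-site carrier -/

/-- The `n`-th site (`n < 16`) of coset `r < 4` of the image `{0,4} × ℤ/8` of `tiltHom16b` in
`(ℤ/8)²`: `(r + 4⌊n/8⌋, n mod 8)`. [folklore] -/
def cosetSite (r : Fin 4) (n : FermionTorus 1 16) : FermionTorus 2 8 :=
  toLex fun i : Fin 2 => if i = 0 then
      ⟨(r : ℕ) + 4 * ((ofLex n 0 : ℕ) / 8), by
        have h1 := r.isLt
        have h2 := (ofLex n 0).isLt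
        omega⟩
    else ⟨(ofLex n 0 : ℕ) % 8, Nat.mod_lt _ (by norm_num)⟩

/-- First coordinate of `cosetSite`. [folklore] -/
@[simp] theorem cosetSite_apply_zero (r : Fin 4) (n : FermionTorus 1 16) :
    ((ofLex (cosetSite r n)) 0 : ℕ) = (r : ℕ) + 4 * ((ofLex n 0 : ℕ) / 8) := rfl

/-- Second coordinate of `cosetSite`. [folklore] -/
@[simp] theorem cosetSite_apply_one (r : Fin 4) (n : FermionTorus 1 16) :
    ((ofLex (cosetSite r n)) 1 : ℕ) = (ofLex n 0 : ℕ) % 8 := rfl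

/-- `cosetSite r` is strictly monotone for the lexicographic (Jordan–Wigner) site orders. [folklore] -/
theorem cosetSite_strictMono (r : Fin 4) : StrictMono (cosetSite r) := by
  intro a b hab
  obtain ⟨i, -, hlt⟩ : ∃ i, (∀ j, j < i → (ofLex a) j = (ofLex b) j) ∧ (ofLex a) i < (ofLex b) i := hab
  have hi : i = 0 := Subsingleton.elim _ _
  subst hi
  have hlt' : (ofLex a 0 : ℕ) < (ofLex b 0 : ℕ) := hlt
  show ∃ i, (∀ j, j < i → ofLex (cosetSite r a) j = ofLex (cosetSite r b) j) ∧
    ofLex (cosetSite r a) i < ofLex (cosetSite r b) i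
  by_cases hq : (ofLex a 0 : ℕ) / 8 < (ofLex b 0 : ℕ) / 8
  · refine ⟨0, fun j hj => absurd hj (Fin.not_lt_zero j), ?_⟩
    rw [Fin.lt_def, cosetSite_apply_zero, cosetSite_apply_zero]
    omega
  · refine ⟨1, fun j hj => ?_, ?_⟩
    · have hj0 : j = 0 := by
        rcases Fin.eq_zero_or_eq_succ j with h | ⟨k, hk⟩
        · exact h
        · exfalso
          have hk0 : k = 0 := Subsingleton.elim _ _
          subst hk0
          subst hk
          exact lt_irrefl _ hj
      subst hj0
      apply Fin.ext
      rw [cosetSite_apply_zero, cosetSite_apply_zero]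
      omega
    · rw [Fin.lt_def, cosetSite_apply_one, cosetSite_apply_one]
      omega

/-- Coset `r` as an order embedding of sites. [folklore] -/
def cosetSiteEmb (r : Fin 4) : FermionTorus 1 16 ↪o FermionTorus 2 8 :=
  OrderEmbedding.ofStrictMono _ (cosetSite_strictMono r)

/-- `cosetSiteEmb` is `cosetSite`. [folklore] -/
@[simp] theorem cosetSiteEmb_apply (r : Fin 4) (n : FermionTorus 1 16) :
    cosetSiteEmb r n = cosetSite r n := rfl

/-- The coset (block) of a site of `(ℤ/8)²`: `x ↦ x₀ mod 4`. [folklore] -/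
def blockOf16b (x : FermionTorus 2 8) : Fin 4 := ⟨(ofLex x 0 : ℕ) % 4, Nat.mod_lt _ (by norm_num)⟩

/-- The position of a site inside its coset: `x ↦ 8⌊x₀/4⌋ + x₁`. [folklore] -/
def posOf16b (x : FermionTorus 2 8) : FermionTorus 1 16 :=
  toLex fun _ => ⟨8 * ((ofLex x 0 : ℕ) / 4) + (ofLex x 1 : ℕ), by
    have h1 := (ofLex x 0).isLt
    have h2 := (ofLex x 1).isLt
    omega⟩

/-- Value of `blockOf16b`. [folklore] -/
@[simp] theorem blockOf16b_val (x : FermionTorus 2 8) : (blockOf16b x : ℕ) = (ofLex x 0 : ℕ) % 4 := rfl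

/-- Value of `posOf16b`. [folklore] -/
@[simp] theorem posOf16b_apply_val (x : FermionTorus 2 8) (i : Fin 1) :
    ((ofLex (posOf16b x)) i : ℕ) = 8 * ((ofLex x 0 : ℕ) / 4) + (ofLex x 1 : ℕ) := rfl

/-- A site is the `posOf16b`-th site of its coset. [folklore] -/
theorem cosetSite_blockOf_posOf (x : FermionTorus 2 8) : cosetSite (blockOf16b x) (posOf16b x) = x := by
  change toLex _ = x
  rw [← toLex_ofLex x]
  congr 1
  funext i
  apply Fin.ext
  have h1 := (ofLex x 0).isLt
  have h2 := (ofLex x 1).isLt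
  by_cases hi : i = 0
  · subst hi
    simp only [if_true, toLex_ofLex, blockOf16b_val, posOf16b_apply_val]
    omega
  · have hi1 : i = 1 := by
      rcases Fin.eq_zero_or_eq_succ i with h | ⟨k, hk⟩
      · exact absurd h hi
      · have hk0 : k = 0 := Subsingleton.elim _ _
        subst hk0
        exact hk
    subst hi1
    simp only [if_neg hi, toLex_ofLex, posOf16b_apply_val]
    omega

/-- `blockOf16b (cosetSite r n) = r`. [folklore] -/
theorem blockOf_cosetSite (r : Fin 4) (n : FermionTorus 1 16) : blockOf16b (cosetSite r n) = r := by
  apply Fin.ext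
  rw [blockOf16b_val, cosetSite_apply_zero]
  have h := r.isLt
  omega

/-- `posOf16b (cosetSite r n) = n`. [folklore] -/
theorem posOf_cosetSite (r : Fin 4) (n : FermionTorus 1 16) : posOf16b (cosetSite r n) = n := by
  change toLex _ = n
  rw [← toLex_ofLex n]
  congr 1
  funext i
  have hi : i = 0 := Subsingleton.elim _ _
  subst hi
  apply Fin.ext
  simp only [toLex_ofLex, cosetSite_apply_zero, cosetSite_apply_one]
  have h := r.isLt
  omega

/-- Sites of different cosets differ. [folklore] -/
theorem cosetSite_ne_of_ne {r r' : Fin 4} (h : r ≠ r') (a b : FermionTorus 1 16) :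
    cosetSite r a ≠ cosetSite r' b := by
  intro h'
  apply h
  rw [← blockOf_cosetSite r a, h', blockOf_cosetSite]

/-- The coset images cover `(ℤ/8)²`. [folklore] -/
theorem biUnion_map_cosetSiteEmb_eq_univ :
    (Finset.univ.biUnion fun r : Fin 4 =>
      (Finset.univ : Finset (FermionTorus 1 16)).map (cosetSiteEmb r).toEmbedding) = Finset.univ := by
  ext x
  simp only [Finset.mem_biUnion, Finset.mem_univ, true_and, Finset.mem_map, RelEmbedding.coe_toEmbedding,
    cosetSiteEmb_apply, iff_true]
  exact ⟨blockOf16b x, posOf16b x, cosetSite_blockOf_posOf x⟩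

/-- **The site partition of `(ℤ/8)²` into the four cosets** (clusters `r : Fin 4`, internal sites
`FermionTorus 1 16`, embeddings `cosetSiteEmb`). [folklore] -/
def tilt16bSitePartition : ClusterProduct.Partition (FermionTorus 2 8) (Fin 4) (FermionTorus 1 16) where
  emb := cosetSiteEmb
  cl := blockOf16b
  idx := posOf16b
  emb_cl_idx x := cosetSite_blockOf_posOf x
  cl_emb r n := blockOf_cosetSite r n
  idx_emb r n := posOf_cosetSite r n

/-- **The orbital partition of `Orb (ℤ/8)²` into the four cosets** (embeddings `orbEmb (cosetSiteEmb r)`,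
`(n, σ) ↦ (cosetSite r n, σ)`). [folklore] -/
def tilt16bPartition : ClusterProduct.Partition (Orb (FermionTorus 2 8)) (Fin 4) (Orb (FermionTorus 1 16)) where
  emb r := orbEmb (cosetSiteEmb r)
  cl o := blockOf16b (ofLex o).1
  idx o := orb (posOf16b (ofLex o).1) (ofLex o).2
  emb_cl_idx o := by
    change orb (cosetSite (blockOf16b (ofLex o).1) (posOf16b (ofLex o).1)) (ofLex o).2 = o
    rw [cosetSite_blockOf_posOf]
    rfl
  cl_emb r a := by
    change blockOf16b (cosetSite r (ofLex a).1) = r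
    exact blockOf_cosetSite r _
  idx_emb r a := by
    change orb (posOf16b (cosetSite r (ofLex a).1)) (ofLex a).2 = a
    rw [posOf_cosetSite]
    rfl

/-- The embeddings of the orbital partition. [folklore] -/
@[simp] theorem tilt16bPartition_emb (r : Fin 4) : tilt16bPartition.emb r = orbEmb (cosetSiteEmb r) := rfl

/-! ### §2. The 16-site carrier graph and the block decomposition of `homHubbard tiltHom16b` -/

/-- The torus sites of coset `r` are the translates by `(r, 0)` of those of coset `0`. [folklore] -/
theorem toTorusSite_cosetSite (r : Fin 4) (n : FermionTorus 1 16) :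
    FermionTorus.toTorusSite (cosetSite r n) =
      FermionTorus.toTorusSite (cosetSite 0 n) + (fun i : Fin 2 => if i = 0 then ((r : ℕ) : ZMod 8) else 0) := by
  funext i
  simp only [FermionTorus.toTorusSite, Pi.add_apply]
  by_cases hi : i = 0
  · subst hi
    rw [if_pos rfl, cosetSite_apply_zero, cosetSite_apply_zero]
    push_cast
    simp only [Fin.val_zero, Nat.cast_zero, zero_add]
    ring
  · have hi1 : i = 1 := by
      rcases Fin.eq_zero_or_eq_succ i with h | ⟨k, hk⟩
      · exact absurd h hi
      · have hk0 : k = 0 := Subsingleton.elim _ _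
        subst hk0
        exact hk
    subst hi1
    rw [if_neg hi, cosetSite_apply_one, cosetSite_apply_one, add_zero]

/-- **The 16-site carrier graph of `Λ₁₆″`**: the pull-back of `homTorusGraph tiltHom16b` along the
coset-`0` embedding `n ↦ (4⌊n/8⌋, n mod 8)`; i.e. the Cayley graph of `ℤ/2 × ℤ/8` with connection set
`{±(0,1), ±(1,2)}` read through `n = 8a + b`. [folklore] -/
def tilt16bGraph : SimpleGraph (FermionTorus 1 16) := (homTorusGraph tiltHom16b).comap (cosetSite 0)

/-- Adjacency of `tilt16bGraph` (definitional). [folklore] -/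
theorem tilt16bGraph_adj (a b : FermionTorus 1 16) :
    tilt16bGraph.Adj a b ↔ (homTorusGraph tiltHom16b).Adj (cosetSite 0 a) (cosetSite 0 b) := Iff.rfl

/-- Adjacency of `tilt16bGraph` is decidable. [folklore] -/
instance instDecidableRelTilt16bGraphAdj : DecidableRel tilt16bGraph.Adj := fun a b =>
  inferInstanceAs (Decidable ((homTorusGraph tiltHom16b).Adj (cosetSite 0 a) (cosetSite 0 b)))

/-- **Every coset carries the same graph**: `a ∼ b` in `tilt16bGraph` iff `cosetSite r a ∼ cosetSite r b`
in `homTorusGraph tiltHom16b` (translation by `(r,0)` is an automorphism). [folklore] -/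
theorem tilt16bGraph_adj_iff_coset (r : Fin 4) (a b : FermionTorus 1 16) :
    tilt16bGraph.Adj a b ↔ (homTorusGraph tiltHom16b).Adj (cosetSite r a) (cosetSite r b) := by
  rw [tilt16bGraph_adj, homTorusGraph_adj, homTorusGraph_adj, toTorusSite_cosetSite r a,
    toTorusSite_cosetSite r b, homSiteGraph_adj_add_right]

/-- The hops `±(4,2), ±(0,1)` preserve `x₀ mod 4`: adjacent sites lie in the same coset. [folklore] -/
theorem blockOf_eq_of_adj {x y : FermionTorus 2 8} (h : (homTorusGraph tiltHom16b).Adj x y) :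
    blockOf16b x = blockOf16b y := by
  rw [homTorusGraph_adj, homSiteGraph_adj_iff] at h
  obtain ⟨-, i, hi⟩ := h
  have hφ0 : ∀ i : Fin 2, tiltHom16b (unitVec i) 0 = ((![![4, 0], ![2, 1]] 0 i : ℤ) : ZMod 8) := fun i => by
    show latHom 8 _ (unitVec i) 0 = _
    rw [latHom_unitVec]
  have key : ∀ (x y : FermionTorus 2 8) (i : Fin 2),
      y.toTorusSite = x.toTorusSite + tiltHom16b (unitVec i) → (ofLex y 0 : ℕ) % 4 = (ofLex x 0 : ℕ) % 4 := by
    intro x y i h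
    have h0 := congrFun h 0
    simp only [FermionTorus.toTorusSite, Pi.add_apply, hφ0] at h0
    have hx := (ofLex x 0).isLt
    have hy := (ofLex y 0).isLt
    by_cases hi : i = 0
    · subst hi
      have h4 : ((ofLex y 0 : ℕ) : ZMod 8) = (((ofLex x 0 : ℕ) + 4 : ℕ) : ZMod 8) := by
        rw [h0]
        simp only [Matrix.cons_val_zero]
        push_cast
        ring
      have h8 := (ZMod.natCast_eq_natCast_iff' _ _ 8).1 h4
      omega
    · have hi1 : i = 1 := by
        rcases Fin.eq_zero_or_eq_succ i with h | ⟨k, hk⟩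
        · exact absurd h hi
        · have hk0 : k = 0 := Subsingleton.elim _ _
          subst hk0
          exact hk
      subst hi1
      have h4 : ((ofLex y 0 : ℕ) : ZMod 8) = (((ofLex x 0 : ℕ)) : ZMod 8) := by
        rw [h0]
        simp only [Matrix.cons_val_one, Matrix.cons_val_zero]
        push_cast
        ring
      have h8 := (ZMod.natCast_eq_natCast_iff' _ _ 8).1 h4
      omega
  apply Fin.ext
  rw [blockOf16b_val, blockOf16b_val]
  rcases hi with h | h
  · exact (key x y i h).symm
  · exact key y x i h

set_option maxRecDepth 20000 in
/-- **Block decomposition**: the 64-site model of Part V-c is the sum of the four embedded copies of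
the 16-site Hubbard Hamiltonian of `Λ₁₆″`,
`homHubbard tiltHom16b t U = Σ_{r<4} jwEmbed (orbEmb (cosetSiteEmb r)) (hamiltonian tilt16bGraph t U)`:
the block cut `sourced_sub_sum_jwEmbed_sub_onSiteSum_eq` along the four cosets has no cross bonds
(`blockOf_eq_of_adj`) and no left-over sites (`cosetSite_blockOf_posOf`).
[cite: BratteliRobinsonII1997, §5.2.2] -/
theorem homHubbard_tiltHom16b_eq_sum_jwEmbed (t U : ℝ) :
    homHubbard tiltHom16b t U =
      ∑ r : Fin 4, jwEmbed (orbEmb (cosetSiteEmb r)) (hamiltonian tilt16bGraph t U) := by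
  have hcut := sourced_sub_sum_jwEmbed_sub_onSiteSum_eq (Finset.univ : Finset (Fin 4)) cosetSiteEmb
    (fun r _ r' _ hne x y => cosetSite_ne_of_ne hne x y) (homTorusGraph tiltHom16b) tilt16bGraph
    (fun r _ x y => tilt16bGraph_adj_iff_coset r x y) t U 0 0 0 0 (fun _ _ _ => rfl)
  simp only [Complex.ofReal_zero, zero_smul, sub_zero, hamiltonianWith_zero] at hcut
  -- no cross bonds: every coupling outside the coset images vanishes
  have hzero : ∀ (S : Finset (Bond (FermionTorus 2 8))),
      (∀ b, b ∉ S → hubbardCoupling (homTorusGraph tiltHom16b) (t : ℂ) b = 0) →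
      ∑ b ∈ Sᶜ, hubbardCoupling (homTorusGraph tiltHom16b) (t : ℂ) b • bondOp b = 0 :=
    fun S hS => Finset.sum_eq_zero fun b hb => by rw [hS b (Finset.mem_compl.1 hb), zero_smul]
  have hcoup : ∀ b : Bond (FermionTorus 2 8),
      b ∉ (Finset.univ.biUnion fun r : Fin 4 =>
        (Finset.univ : Finset (Bond (FermionTorus 1 16))).map ⟨bondMap (cosetSiteEmb r), bondMap_injective _⟩) →
      hubbardCoupling (homTorusGraph tiltHom16b) (t : ℂ) b = 0 := by
    rintro ⟨x, y, σ⟩ hb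
    rw [hubbardCoupling_apply, if_neg]
    intro hadj
    apply hb
    have hblk : blockOf16b x = blockOf16b y := blockOf_eq_of_adj hadj
    simp only [Finset.mem_biUnion, Finset.mem_univ, true_and, Finset.mem_map, Function.Embedding.coeFn_mk]
    refine ⟨blockOf16b x, (posOf16b x, posOf16b y, σ), ?_⟩
    have hy : cosetSite (blockOf16b x) (posOf16b y) = y := by rw [hblk, cosetSite_blockOf_posOf]
    simp only [bondMap, cosetSiteEmb_apply, cosetSite_blockOf_posOf, hy]
  -- no left-over sites: the on-site remainder is an empty sum
  have hrest : ∀ (S : Finset (FermionTorus 2 8)), (∀ x, x ∈ S) → onSiteSum (U : ℂ) 0 Sᶜ = 0 := by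
    intro S hS
    rw [onSiteSum]
    exact Finset.sum_eq_zero fun x hx => absurd (hS x) (Finset.mem_compl.1 hx)
  have hcov : ∀ x : FermionTorus 2 8, x ∈ (Finset.univ.biUnion fun r : Fin 4 =>
      (Finset.univ : Finset (FermionTorus 1 16)).map (cosetSiteEmb r).toEmbedding) := by
    intro x
    simp only [Finset.mem_biUnion, Finset.mem_univ, true_and, Finset.mem_map, RelEmbedding.coe_toEmbedding,
      cosetSiteEmb_apply]
    exact ⟨blockOf16b x, posOf16b x, cosetSite_blockOf_posOf x⟩
  rw [hzero _ hcoup, hrest _ hcov, neg_zero, sub_zero] at hcut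
  rw [homHubbard]
  exact sub_eq_zero.1 hcut

end Tilt16bCosets

end Summit.Ventures.CertifiedManyBodySolver.Rows

end
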